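import Literature.Analysis.FluidPDE.NavierStokesConcentrationTools
import Literature.Analysis.FluidPDE.Wei2016HardyCutoff
import Literature.Analysis.Calculus.SmoothCutoff
import HarnessLib

/-!
# Tools for the energy iteration of Buckmaster–Vicol (Ann. of Math. 189 (2019), §7): smooth
  cut-offs with derivative bounds, the calculus of the energy profile `t ↦ ∫|u(t)|²`, and the
  pump profiles

Analysis/FluidPDE support file (everything proved; definitions are explicit constructions):

* affine cut-offs `cut a h = S((· - a)/h)` of Mathlib's smooth transition `S`, with the absolute
  bounds `D₁, D₂` of `|S'|, |S''|` and hence `|cut'| ≤ D₁/h`, `|cut''| ≤ D₂/h²`;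
* the energy profile `t ↦ ∫ ‖u(t,x)‖² dx` of a jointly smooth field on `[0,T] × 𝕋ᵈ`: `C^∞` on
  `[0,T]`, first and second derivative within `[0,T]` and their bounds `2B₀Bₜ`, `2(Bₜ² + B₀Bₜₜ)`;
  the elementary bound `|∫‖u‖² - ∫‖v‖²| ≤ (2B + D)D`;
* chain rule within `[0,T]` for `g ∘ G` up to order two with bounds;
* the pump profiles of BV 2019, §7: the smooth core `h_δ ≥ δ/16` with `h_δ(y) = y - δ/4` for
  `y ≥ 3δ/8`, the profile `ψ_δ = √h_δ · cut(3δ/8, δ/8)` (`ψ_δ² = (y - δ/4)·cut²`, `ψ_δ = 0` for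
  `y ≤ 3δ/8`, `ψ_δ² = y - δ/4` for `y ≥ δ/2`), and the floor function `floorFun c` (`= y` for
  `y ≥ c`, `≥ c/2 > 0`), all with explicit derivative bounds.

## References

* T. Buckmaster, V. Vicol, Ann. of Math. 189 (2019) = arXiv:1709.10033, §7 (the energy iterate:
  cut-offs in time of the energy gap, (7.1)–(7.6)). [`BuckmasterVicol2019Annals`]
-/

noncomputable section

open MeasureTheory Set Filter Topology Function
open scoped InnerProductSpace ContDiff ENNReal NNReal

namespace Literature.Analysis.FluidPDE

namespace EnergyPump

open Literature.Analysis.FunctionSpaces FunctionSpaces.Torus Literature.Analysis.Calculus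

/-! ## The smooth transition: bounds of the first two derivatives

(The vanishing of `S''` off `(0,1)` and its boundedness are
`Carleman.exists_bound_deriv_deriv_smoothTransition`, `Wei2016.deriv_deriv_smoothTransition_of_nonpos`,
`Wei2016.deriv_deriv_smoothTransition_of_one_le` of `FluidPDE/BackwardUniquenessCutoff`,
`FluidPDE/Wei2016HardyCutoff`.) -/

/-- An absolute bound of `|S'|`. [folklore] -/
def D₁ : ℝ := Classical.choose exists_bound_deriv_smoothTransition

/-- An absolute bound of `|S''|`. [folklore] -/
def D₂ : ℝ := Classical.choose Carleman.exists_bound_deriv_deriv_smoothTransition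

/-- `D₁ ≥ 0`. [folklore] -/
theorem D₁_nonneg : 0 ≤ D₁ := (Classical.choose_spec exists_bound_deriv_smoothTransition).1

/-- `D₂ ≥ 0`. [folklore] -/
theorem D₂_nonneg : 0 ≤ D₂ := (Classical.choose_spec Carleman.exists_bound_deriv_deriv_smoothTransition).1

/-- `|S'| ≤ D₁`. [folklore] -/
theorem abs_deriv_smoothTransition_le (t : ℝ) : |deriv Real.smoothTransition t| ≤ D₁ :=
  (Classical.choose_spec exists_bound_deriv_smoothTransition).2 t

/-- `|S''| ≤ D₂`. [folklore] -/
theorem abs_deriv_deriv_smoothTransition_le (t : ℝ) : |deriv (deriv Real.smoothTransition) t| ≤ D₂ :=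
  (Classical.choose_spec Carleman.exists_bound_deriv_deriv_smoothTransition).2 t

/-! ## Affine cut-offs -/

/-- **The affine cut-off** `cut a h y = S((y - a)/h)`: for `h > 0` it is `0` for `y ≤ a`, `1` for
`y ≥ a + h`, smooth, with values in `[0,1]`. [folklore] -/
def cut (a h y : ℝ) : ℝ := Real.smoothTransition ((y - a) / h)

/-- `cut = 0` below `a`. [folklore] -/
theorem cut_of_le {a h y : ℝ} (hh : 0 < h) (hy : y ≤ a) : cut a h y = 0 :=
  Real.smoothTransition.zero_of_nonpos (div_nonpos_of_nonpos_of_nonneg (by linarith) hh.le)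

/-- `cut = 1` above `a + h`. [folklore] -/
theorem cut_of_ge {a h y : ℝ} (hh : 0 < h) (hy : a + h ≤ y) : cut a h y = 1 :=
  Real.smoothTransition.one_of_one_le ((one_le_div hh).2 (by linarith))

/-- `0 ≤ cut ≤ 1`. [folklore] -/
theorem cut_mem (a h y : ℝ) : 0 ≤ cut a h y ∧ cut a h y ≤ 1 :=
  ⟨Real.smoothTransition.nonneg _, Real.smoothTransition.le_one _⟩

/-- `cut a h` is smooth. [folklore] -/
theorem contDiff_cut (a h : ℝ) {n : ℕ∞} : ContDiff ℝ n (cut a h) :=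
  Real.smoothTransition.contDiff.comp ((contDiff_id.sub contDiff_const).div_const h)

/-- The derivative of `cut a h`. [folklore] -/
theorem hasDerivAt_cut (a h y : ℝ) : HasDerivAt (cut a h) (h⁻¹ * deriv Real.smoothTransition ((y - a) / h)) y := by
  have h1 : HasDerivAt Real.smoothTransition (deriv Real.smoothTransition ((y - a) / h)) ((y - a) / h) :=
    (differentiable_smoothTransition _).hasDerivAt
  have h2 : HasDerivAt (fun s => (s - a) / h) h⁻¹ y := by
    simpa [div_eq_mul_inv] using ((hasDerivAt_id y).sub_const a).div_const h
  have key := h1.comp y h2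
  rw [mul_comm] at key
  exact key

/-- `deriv (cut a h)`. [folklore] -/
theorem deriv_cut (a h : ℝ) : deriv (cut a h) = fun y => h⁻¹ * deriv Real.smoothTransition ((y - a) / h) :=
  funext fun y => (hasDerivAt_cut a h y).deriv

/-- `|cut'| ≤ D₁/h`. [folklore] -/
theorem abs_deriv_cut_le {a h : ℝ} (hh : 0 < h) (y : ℝ) : |deriv (cut a h) y| ≤ D₁ / h := by
  rw [deriv_cut]
  show |h⁻¹ * deriv Real.smoothTransition ((y - a) / h)| ≤ D₁ / h
  rw [abs_mul, abs_of_pos (inv_pos.2 hh)]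
  calc h⁻¹ * |deriv Real.smoothTransition ((y - a) / h)| ≤ h⁻¹ * D₁ := mul_le_mul_of_nonneg_left (abs_deriv_smoothTransition_le _) (inv_pos.2 hh).le
    _ = D₁ / h := by rw [div_eq_inv_mul]

/-- The second derivative of `cut a h`. [folklore] -/
theorem hasDerivAt_deriv_cut (a h y : ℝ) :
    HasDerivAt (deriv (cut a h)) (h⁻¹ * (h⁻¹ * deriv (deriv Real.smoothTransition) ((y - a) / h))) y := by
  rw [deriv_cut]
  have hdiff : Differentiable ℝ (deriv Real.smoothTransition) :=
    (contDiff_infty_iff_deriv.1 Real.smoothTransition.contDiff).2.differentiable (by simp)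
  have h1 : HasDerivAt (deriv Real.smoothTransition) (deriv (deriv Real.smoothTransition) ((y - a) / h)) ((y - a) / h) :=
    (hdiff _).hasDerivAt
  have h2 : HasDerivAt (fun s => (s - a) / h) h⁻¹ y := by
    simpa [div_eq_mul_inv] using ((hasDerivAt_id y).sub_const a).div_const h
  have key := (h1.comp y h2).const_mul h⁻¹
  exact key.congr_deriv (by ring)

/-- `|cut''| ≤ D₂/h²`. [folklore] -/
theorem abs_deriv_deriv_cut_le {a h : ℝ} (hh : 0 < h) (y : ℝ) : |deriv (deriv (cut a h)) y| ≤ D₂ / h ^ 2 := by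
  rw [(hasDerivAt_deriv_cut a h y).deriv, abs_mul, abs_mul, abs_of_pos (inv_pos.2 hh)]
  have h0 : 0 ≤ h⁻¹ := (inv_pos.2 hh).le
  calc h⁻¹ * (h⁻¹ * |deriv (deriv Real.smoothTransition) ((y - a) / h)|) ≤ h⁻¹ * (h⁻¹ * D₂) :=
        mul_le_mul_of_nonneg_left (mul_le_mul_of_nonneg_left (abs_deriv_deriv_smoothTransition_le _) h0) h0
    _ = D₂ / h ^ 2 := by field_simp

/-- `cut' = 0` below `a`. [folklore] -/
theorem deriv_cut_of_le {a h y : ℝ} (hh : 0 < h) (hy : y ≤ a) : deriv (cut a h) y = 0 := by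
  rw [deriv_cut]
  show h⁻¹ * deriv Real.smoothTransition ((y - a) / h) = 0
  rw [deriv_smoothTransition_of_nonpos (div_nonpos_of_nonpos_of_nonneg (by linarith) hh.le), mul_zero]

/-- `cut' = 0` above `a + h`. [folklore] -/
theorem deriv_cut_of_ge {a h y : ℝ} (hh : 0 < h) (hy : a + h ≤ y) : deriv (cut a h) y = 0 := by
  rw [deriv_cut]
  show h⁻¹ * deriv Real.smoothTransition ((y - a) / h) = 0
  rw [deriv_smoothTransition_of_one_le ((one_le_div hh).2 (by linarith)), mul_zero]

/-- `cut'' = 0` below `a`. [folklore] -/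
theorem deriv_deriv_cut_of_le {a h y : ℝ} (hh : 0 < h) (hy : y ≤ a) : deriv (deriv (cut a h)) y = 0 := by
  rw [(hasDerivAt_deriv_cut a h y).deriv, Wei2016.deriv_deriv_smoothTransition_of_nonpos (div_nonpos_of_nonpos_of_nonneg (by linarith) hh.le)]
  simp

/-- `cut'' = 0` above `a + h`. [folklore] -/
theorem deriv_deriv_cut_of_ge {a h y : ℝ} (hh : 0 < h) (hy : a + h ≤ y) : deriv (deriv (cut a h)) y = 0 := by
  rw [(hasDerivAt_deriv_cut a h y).deriv, Wei2016.deriv_deriv_smoothTransition_of_one_le ((one_le_div hh).2 (by linarith))]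
  simp

/-- `cut > 0` strictly above `a`. [folklore] -/
theorem cut_pos {a h y : ℝ} (hh : 0 < h) (hy : a < y) : 0 < cut a h y :=
  Real.smoothTransition.pos_of_pos (div_pos (by linarith) hh)

/-! ## The energy profile of a jointly smooth field -/

section Energy

variable {d : Type*} [Fintype d] {E : Type*} [NormedAddCommGroup E] [InnerProductSpace ℝ E]
  {T : ℝ} {u v : ℝ → UnitAddTorus d → E}

/-- `‖u‖²` is jointly smooth. [folklore] -/
theorem isSmoothSpaceTimeOn_norm_sq {S : Set ℝ} (hu : FunctionSpaces.Torus.IsSmoothSpaceTimeOn S u) : FunctionSpaces.Torus.IsSmoothSpaceTimeOn S (fun t x => ‖u t x‖ ^ 2) := by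
  have h := hu.inner hu
  refine (show (fun t x => ‖u t x‖ ^ 2) = fun t x => ⟪u t x, u t x⟫_ℝ from ?_) ▸ h
  funext t x; exact (real_inner_self_eq_norm_sq _).symm

/-- `∂ₜ‖u‖² = 2⟪u, ∂ₜu⟫` within `[0,T]`. [folklore] -/
theorem timeDerivWithin_norm_sq (hT : 0 < T) (hu : FunctionSpaces.Torus.IsSmoothSpaceTimeOn (Icc 0 T) u) {t : ℝ} (ht : t ∈ Icc 0 T) (x : UnitAddTorus d) :
    Torus.timeDerivWithin (Icc 0 T) (fun s y => ‖u s y‖ ^ 2) t x = 2 * ⟪u t x, Torus.timeDerivWithin (Icc 0 T) u t x⟫_ℝ := by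
  have e : (fun s y => ‖u s y‖ ^ 2) = fun s y => ⟪u s y, u s y⟫_ℝ := by funext s y; exact (real_inner_self_eq_norm_sq _).symm
  rw [e, hu.timeDerivWithin_inner hu (uniqueDiffOn_Icc hT) ht x, real_inner_comm]
  ring

/-- **The energy profile is smooth**: `t ↦ ∫‖u(t)‖²` is `C^∞` on `[0,T]`. [folklore] -/
theorem contDiffOn_energy (hT : 0 < T) (hu : FunctionSpaces.Torus.IsSmoothSpaceTimeOn (Icc 0 T) u) :
    ContDiffOn ℝ ∞ (fun t => ∫ x, ‖u t x‖ ^ 2) (Icc 0 T) :=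
  (isSmoothSpaceTimeOn_norm_sq hu).contDiffOn_integral (uniqueDiffOn_Icc hT) (convex_Icc 0 T)

/-- **The derivative of the energy profile**: `d/dt ∫‖u‖² = ∫ 2⟪u, ∂ₜu⟫` within `[0,T]`. [folklore] -/
theorem hasDerivWithinAt_energy (hT : 0 < T) (hu : FunctionSpaces.Torus.IsSmoothSpaceTimeOn (Icc 0 T) u) {t : ℝ} (ht : t ∈ Icc 0 T) :
    HasDerivWithinAt (fun s => ∫ x, ‖u s x‖ ^ 2) (∫ x, 2 * ⟪u t x, Torus.timeDerivWithin (Icc 0 T) u t x⟫_ℝ) (Icc 0 T) t := by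
  have h := (isSmoothSpaceTimeOn_norm_sq hu).hasDerivWithinAt_integral (convex_Icc 0 T) ht
  have e : ∫ x, Torus.timeDerivWithin (Icc 0 T) (fun s y => ‖u s y‖ ^ 2) t x = ∫ x, 2 * ⟪u t x, Torus.timeDerivWithin (Icc 0 T) u t x⟫_ℝ :=
    integral_congr_ae (Eventually.of_forall fun x => timeDerivWithin_norm_sq hT hu ht x)
  rw [← e]; exact h

/-- `derivWithin` of the energy profile. [folklore] -/
theorem derivWithin_energy (hT : 0 < T) (hu : FunctionSpaces.Torus.IsSmoothSpaceTimeOn (Icc 0 T) u) {t : ℝ} (ht : t ∈ Icc 0 T) :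
    derivWithin (fun s => ∫ x, ‖u s x‖ ^ 2) (Icc 0 T) t = ∫ x, 2 * ⟪u t x, Torus.timeDerivWithin (Icc 0 T) u t x⟫_ℝ :=
  (hasDerivWithinAt_energy hT hu ht).derivWithin (uniqueDiffOn_Icc hT t ht)

/-- **`|d/dt ∫‖u‖²| ≤ 2B₀Bₜ`**. [folklore] -/
theorem abs_derivWithin_energy_le (hT : 0 < T) (hu : FunctionSpaces.Torus.IsSmoothSpaceTimeOn (Icc 0 T) u) {B₀ Bt : ℝ}
    (h0 : ∀ t ∈ Icc 0 T, ∀ x, ‖u t x‖ ≤ B₀) (h1 : ∀ t ∈ Icc 0 T, ∀ x, ‖Torus.timeDerivWithin (Icc 0 T) u t x‖ ≤ Bt)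
    {t : ℝ} (ht : t ∈ Icc 0 T) : |derivWithin (fun s => ∫ x, ‖u s x‖ ^ 2) (Icc 0 T) t| ≤ 2 * B₀ * Bt := by
  rw [derivWithin_energy hT hu ht]
  have hB0 : 0 ≤ B₀ := (norm_nonneg _).trans (h0 t ht 0)
  have hc : Continuous fun x => 2 * ⟪u t x, Torus.timeDerivWithin (Icc 0 T) u t x⟫_ℝ :=
    ((hu.isSmooth_slice ht).continuous.inner ((hu.timeDerivWithin (uniqueDiffOn_Icc hT)).isSmooth_slice ht).continuous).const_mul 2
  calc |∫ x, 2 * ⟪u t x, Torus.timeDerivWithin (Icc 0 T) u t x⟫_ℝ| ≤ ∫ x, |2 * ⟪u t x, Torus.timeDerivWithin (Icc 0 T) u t x⟫_ℝ| := abs_integral_le_integral_abs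
    _ ≤ ∫ _x : UnitAddTorus d, 2 * B₀ * Bt := by
        refine integral_mono hc.abs.integrable_unitAddTorus (integrable_const _) fun x => ?_
        rw [abs_mul, abs_two]
        have := abs_real_inner_le_norm (u t x) (Torus.timeDerivWithin (Icc 0 T) u t x)
        have := mul_le_mul (h0 t ht x) (h1 t ht x) (norm_nonneg _) hB0
        nlinarith
    _ = 2 * B₀ * Bt := by simp

/-- **The second derivative of the energy profile** within `[0,T]`:
`d²/dt² ∫‖u‖² = ∫ 2(⟪∂ₜu, ∂ₜu⟫ + ⟪u, ∂ₜ∂ₜu⟫)`. [folklore] -/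
theorem derivWithin_derivWithin_energy (hT : 0 < T) (hu : FunctionSpaces.Torus.IsSmoothSpaceTimeOn (Icc 0 T) u) {t : ℝ} (ht : t ∈ Icc 0 T) :
    derivWithin (derivWithin (fun s => ∫ x, ‖u s x‖ ^ 2) (Icc 0 T)) (Icc 0 T) t =
      ∫ x, 2 * (⟪Torus.timeDerivWithin (Icc 0 T) u t x, Torus.timeDerivWithin (Icc 0 T) u t x⟫_ℝ +
        ⟪u t x, Torus.timeDerivWithin (Icc 0 T) (Torus.timeDerivWithin (Icc 0 T) u) t x⟫_ℝ) := by
  have hU := uniqueDiffOn_Icc hT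
  have hut := hu.timeDerivWithin hU
  have hφ : FunctionSpaces.Torus.IsSmoothSpaceTimeOn (Icc 0 T) (fun s y => 2 * ⟪u s y, Torus.timeDerivWithin (Icc 0 T) u s y⟫_ℝ) :=
    contDiffOn_const.mul (hu.inner hut)
  -- `derivWithin E = ∫ 2⟪u, ∂ₜu⟫` on `[0,T]`
  have heq : EqOn (derivWithin (fun s => ∫ x, ‖u s x‖ ^ 2) (Icc 0 T)) (fun s => ∫ x, 2 * ⟪u s x, Torus.timeDerivWithin (Icc 0 T) u s x⟫_ℝ) (Icc 0 T) :=
    fun s hs => derivWithin_energy hT hu hs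
  rw [derivWithin_congr heq (heq ht), ((hφ.hasDerivWithinAt_integral (convex_Icc 0 T) ht).derivWithin (hU t ht))]
  refine integral_congr_ae (Eventually.of_forall fun x => ?_)
  have e1 : Torus.timeDerivWithin (Icc 0 T) (fun s y => 2 * ⟪u s y, Torus.timeDerivWithin (Icc 0 T) u s y⟫_ℝ) t x =
      2 * Torus.timeDerivWithin (Icc 0 T) (fun s y => ⟪u s y, Torus.timeDerivWithin (Icc 0 T) u s y⟫_ℝ) t x := by
    show derivWithin (fun s => 2 * ⟪u s x, Torus.timeDerivWithin (Icc 0 T) u s x⟫_ℝ) (Icc 0 T) t = 2 * derivWithin (fun s => ⟪u s x, Torus.timeDerivWithin (Icc 0 T) u s x⟫_ℝ) (Icc 0 T) t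
    exact derivWithin_const_mul (2 : ℝ) (((hu.inner hut).hasDerivWithinAt_slice ht x).differentiableWithinAt)
  rw [e1, hu.timeDerivWithin_inner hut hU ht x]
  beta_reduce
  ring

/-- **`|d²/dt² ∫‖u‖²| ≤ 2(Bₜ² + B₀Bₜₜ)`**. [folklore] -/
theorem abs_derivWithin_derivWithin_energy_le (hT : 0 < T) (hu : FunctionSpaces.Torus.IsSmoothSpaceTimeOn (Icc 0 T) u) {B₀ Bt Btt : ℝ}
    (h0 : ∀ t ∈ Icc 0 T, ∀ x, ‖u t x‖ ≤ B₀) (h1 : ∀ t ∈ Icc 0 T, ∀ x, ‖Torus.timeDerivWithin (Icc 0 T) u t x‖ ≤ Bt)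
    (h2 : ∀ t ∈ Icc 0 T, ∀ x, ‖Torus.timeDerivWithin (Icc 0 T) (Torus.timeDerivWithin (Icc 0 T) u) t x‖ ≤ Btt)
    {t : ℝ} (ht : t ∈ Icc 0 T) :
    |derivWithin (derivWithin (fun s => ∫ x, ‖u s x‖ ^ 2) (Icc 0 T)) (Icc 0 T) t| ≤ 2 * (Bt * Bt + B₀ * Btt) := by
  rw [derivWithin_derivWithin_energy hT hu ht]
  have hU := uniqueDiffOn_Icc hT
  have hB0 : 0 ≤ B₀ := (norm_nonneg _).trans (h0 t ht 0)
  have hBt : 0 ≤ Bt := (norm_nonneg _).trans (h1 t ht 0)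
  have cut' := ((hu.timeDerivWithin hU).isSmooth_slice ht).continuous
  have cutt := (((hu.timeDerivWithin hU).timeDerivWithin hU).isSmooth_slice ht).continuous
  have hc : Continuous fun x => 2 * (⟪Torus.timeDerivWithin (Icc 0 T) u t x, Torus.timeDerivWithin (Icc 0 T) u t x⟫_ℝ +
      ⟪u t x, Torus.timeDerivWithin (Icc 0 T) (Torus.timeDerivWithin (Icc 0 T) u) t x⟫_ℝ) :=
    ((cut'.inner cut').add ((hu.isSmooth_slice ht).continuous.inner cutt)).const_mul 2
  calc _ ≤ ∫ x, |2 * (⟪Torus.timeDerivWithin (Icc 0 T) u t x, Torus.timeDerivWithin (Icc 0 T) u t x⟫_ℝ +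
        ⟪u t x, Torus.timeDerivWithin (Icc 0 T) (Torus.timeDerivWithin (Icc 0 T) u) t x⟫_ℝ)| := abs_integral_le_integral_abs
    _ ≤ ∫ _x : UnitAddTorus d, 2 * (Bt * Bt + B₀ * Btt) := by
        refine integral_mono hc.abs.integrable_unitAddTorus (integrable_const _) fun x => ?_
        rw [abs_mul, abs_two]
        have a1 := abs_real_inner_le_norm (Torus.timeDerivWithin (Icc 0 T) u t x) (Torus.timeDerivWithin (Icc 0 T) u t x)
        have a2 := abs_real_inner_le_norm (u t x) (Torus.timeDerivWithin (Icc 0 T) (Torus.timeDerivWithin (Icc 0 T) u) t x)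
        have m1 := mul_le_mul (h1 t ht x) (h1 t ht x) (norm_nonneg _) hBt
        have m2 := mul_le_mul (h0 t ht x) (h2 t ht x) (norm_nonneg _) hB0
        have := abs_add_le (⟪Torus.timeDerivWithin (Icc 0 T) u t x, Torus.timeDerivWithin (Icc 0 T) u t x⟫_ℝ)
          ⟪u t x, Torus.timeDerivWithin (Icc 0 T) (Torus.timeDerivWithin (Icc 0 T) u) t x⟫_ℝ
        nlinarith
    _ = 2 * (Bt * Bt + B₀ * Btt) := by simp

omit [InnerProductSpace ℝ E] in
/-- **`|∫‖u‖² - ∫‖v‖²| ≤ (2B + D)D`** for `‖v‖ ≤ B`, `‖u - v‖ ≤ D` (continuous slices).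
[folklore] -/
theorem abs_integral_norm_sq_sub_le [NormedSpace ℝ E] {u v : UnitAddTorus d → E} (hu : Continuous u) (hv : Continuous v) {B D : ℝ}
    (hB : ∀ x, ‖v x‖ ≤ B) (hD : ∀ x, ‖u x - v x‖ ≤ D) :
    |(∫ x, ‖u x‖ ^ 2) - ∫ x, ‖v x‖ ^ 2| ≤ (2 * B + D) * D := by
  have hB0 : 0 ≤ B := (norm_nonneg _).trans (hB 0)
  have hD0 : 0 ≤ D := (norm_nonneg _).trans (hD 0)
  have hpt : ∀ x, |‖u x‖ ^ 2 - ‖v x‖ ^ 2| ≤ (2 * B + D) * D := by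
    intro x
    have h1 : |‖u x‖ - ‖v x‖| ≤ ‖u x - v x‖ := abs_norm_sub_norm_le _ _
    have h2 : ‖u x‖ ≤ B + D := by
      have : u x = v x + (u x - v x) := by abel
      rw [this]; exact (norm_add_le _ _).trans (add_le_add (hB x) (hD x))
    rw [sq_sub_sq, abs_mul]
    have h3 : |‖u x‖ + ‖v x‖| ≤ 2 * B + D := by
      rw [abs_of_nonneg (by positivity)]; linarith [hB x]
    exact mul_le_mul h3 (h1.trans (hD x)) (abs_nonneg _) (by positivity)
  have iu : Integrable (fun x => ‖u x‖ ^ 2) volume := (hu.norm.pow 2).integrable_unitAddTorus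
  have iv : Integrable (fun x => ‖v x‖ ^ 2) volume := (hv.norm.pow 2).integrable_unitAddTorus
  have iuv : Integrable (fun x => |‖u x‖ ^ 2 - ‖v x‖ ^ 2|) volume := (iu.sub iv).abs
  rw [← integral_sub iu iv]
  calc |∫ x, (‖u x‖ ^ 2 - ‖v x‖ ^ 2)| ≤ ∫ x, |‖u x‖ ^ 2 - ‖v x‖ ^ 2| := abs_integral_le_integral_abs
    _ ≤ ∫ _x : UnitAddTorus d, (2 * B + D) * D := integral_mono iuv (integrable_const _) hpt
    _ = (2 * B + D) * D := by simp

end Energy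

/-! ## Chain rule within `[0,T]`, up to order two -/

section Chain

variable {T : ℝ} {g G : ℝ → ℝ}

/-- `g ∘ G` is `C^∞` on `[0,T]`. [folklore] -/
theorem contDiffOn_comp (hg : ContDiff ℝ ∞ g) (hG : ContDiffOn ℝ ∞ G (Icc 0 T)) : ContDiffOn ℝ ∞ (fun t => g (G t)) (Icc 0 T) :=
  hg.comp_contDiffOn hG

/-- First derivative of `g ∘ G` within `[0,T]`. [folklore] -/
theorem hasDerivWithinAt_comp (hT : 0 < T) (hg : ContDiff ℝ ∞ g) (hG : ContDiffOn ℝ ∞ G (Icc 0 T)) {t : ℝ} (ht : t ∈ Icc 0 T) :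
    HasDerivWithinAt (fun s => g (G s)) (deriv g (G t) * derivWithin G (Icc 0 T) t) (Icc 0 T) t := by
  have _ := hT
  have h1 : HasDerivAt g (deriv g (G t)) (G t) := (hg.differentiable (by simp) _).hasDerivAt
  have h2 : HasDerivWithinAt G (derivWithin G (Icc 0 T) t) (Icc 0 T) t := ((hG.differentiableOn (by simp)) t ht).hasDerivWithinAt
  exact h1.comp_hasDerivWithinAt t h2

/-- `derivWithin (g ∘ G)`. [folklore] -/
theorem derivWithin_comp (hT : 0 < T) (hg : ContDiff ℝ ∞ g) (hG : ContDiffOn ℝ ∞ G (Icc 0 T)) {t : ℝ} (ht : t ∈ Icc 0 T) :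
    derivWithin (fun s => g (G s)) (Icc 0 T) t = deriv g (G t) * derivWithin G (Icc 0 T) t :=
  (hasDerivWithinAt_comp hT hg hG ht).derivWithin (uniqueDiffOn_Icc hT t ht)

/-- **`|(g ∘ G)'| ≤ D₁Λ₁`**. [folklore] -/
theorem abs_derivWithin_comp_le (hT : 0 < T) (hg : ContDiff ℝ ∞ g) (hG : ContDiffOn ℝ ∞ G (Icc 0 T)) {Dg Λ₁ : ℝ}
    (hDg : ∀ y, |deriv g y| ≤ Dg) (hΛ : ∀ t ∈ Icc 0 T, |derivWithin G (Icc 0 T) t| ≤ Λ₁) {t : ℝ} (ht : t ∈ Icc 0 T) :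
    |derivWithin (fun s => g (G s)) (Icc 0 T) t| ≤ Dg * Λ₁ := by
  rw [derivWithin_comp hT hg hG ht, abs_mul]
  exact mul_le_mul (hDg _) (hΛ t ht) (abs_nonneg _) ((abs_nonneg _).trans (hDg (G t)))

/-- `derivWithin G` is `C^∞` on `[0,T]`. [folklore] -/
theorem contDiffOn_derivWithin (hT : 0 < T) (hG : ContDiffOn ℝ ∞ G (Icc 0 T)) : ContDiffOn ℝ ∞ (derivWithin G (Icc 0 T)) (Icc 0 T) := by
  have h := ((contDiffOn_infty_iff_derivWithin (uniqueDiffOn_Icc hT)).1 hG).2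
  simpa using h

/-- **The second derivative of `g ∘ G` within `[0,T]`**:
`(g ∘ G)'' = g''(G) G'² + g'(G) G''`. [folklore] -/
theorem derivWithin_derivWithin_comp (hT : 0 < T) (hg : ContDiff ℝ ∞ g) (hG : ContDiffOn ℝ ∞ G (Icc 0 T)) {t : ℝ} (ht : t ∈ Icc 0 T) :
    derivWithin (derivWithin (fun s => g (G s)) (Icc 0 T)) (Icc 0 T) t =
      deriv (deriv g) (G t) * derivWithin G (Icc 0 T) t ^ 2 + deriv g (G t) * derivWithin (derivWithin G (Icc 0 T)) (Icc 0 T) t := by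
  have hU := uniqueDiffOn_Icc hT
  have heq : EqOn (derivWithin (fun s => g (G s)) (Icc 0 T)) (fun s => deriv g (G s) * derivWithin G (Icc 0 T) s) (Icc 0 T) :=
    fun s hs => derivWithin_comp hT hg hG hs
  rw [derivWithin_congr heq (heq ht)]
  have hg' : ContDiff ℝ ∞ (deriv g) := (contDiff_infty_iff_deriv.1 hg).2
  have h1 : HasDerivWithinAt (fun s => deriv g (G s)) (deriv (deriv g) (G t) * derivWithin G (Icc 0 T) t) (Icc 0 T) t :=
    hasDerivWithinAt_comp hT hg' hG ht
  have hG' := contDiffOn_derivWithin hT hG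
  have h2 : HasDerivWithinAt (derivWithin G (Icc 0 T)) (derivWithin (derivWithin G (Icc 0 T)) (Icc 0 T) t) (Icc 0 T) t :=
    ((hG'.differentiableOn (by simp)) t ht).hasDerivWithinAt
  have key : HasDerivWithinAt (fun s => deriv g (G s) * derivWithin G (Icc 0 T) s)
      (deriv (deriv g) (G t) * derivWithin G (Icc 0 T) t * derivWithin G (Icc 0 T) t +
        deriv g (G t) * derivWithin (derivWithin G (Icc 0 T)) (Icc 0 T) t) (Icc 0 T) t := h1.mul h2
  rw [key.derivWithin (hU t ht)]
  ring

/-- **`|(g ∘ G)''| ≤ D₂Λ₁² + D₁Λ₂`**. [folklore] -/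
theorem abs_derivWithin_derivWithin_comp_le (hT : 0 < T) (hg : ContDiff ℝ ∞ g) (hG : ContDiffOn ℝ ∞ G (Icc 0 T)) {Dg Dg₂ Λ₁ Λ₂ : ℝ}
    (hDg : ∀ y, |deriv g y| ≤ Dg) (hDg₂ : ∀ y, |deriv (deriv g) y| ≤ Dg₂) (hΛ : ∀ t ∈ Icc 0 T, |derivWithin G (Icc 0 T) t| ≤ Λ₁)
    (hΛ₂ : ∀ t ∈ Icc 0 T, |derivWithin (derivWithin G (Icc 0 T)) (Icc 0 T) t| ≤ Λ₂) {t : ℝ} (ht : t ∈ Icc 0 T) :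
    |derivWithin (derivWithin (fun s => g (G s)) (Icc 0 T)) (Icc 0 T) t| ≤ Dg₂ * Λ₁ ^ 2 + Dg * Λ₂ := by
  rw [derivWithin_derivWithin_comp hT hg hG ht]
  have hΛ0 : 0 ≤ Λ₁ := (abs_nonneg _).trans (hΛ t ht)
  refine (abs_add_le _ _).trans (add_le_add ?_ ?_)
  · rw [abs_mul, abs_pow]
    exact mul_le_mul (hDg₂ _) (pow_le_pow_left₀ (abs_nonneg _) (hΛ t ht) 2) (by positivity) ((abs_nonneg _).trans (hDg₂ (G t)))
  · rw [abs_mul]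
    exact mul_le_mul (hDg _) (hΛ₂ t ht) (abs_nonneg _) ((abs_nonneg _).trans (hDg (G t)))

end Chain

/-! ## The pump profiles (BV 2019, §7) -/

section Profiles

variable {δ c : ℝ}

/-- **The smooth core** `h_δ(y) = δ/16 + cut(5δ/16, δ/16)(y) · (y - 5δ/16)`: `≥ δ/16`, and
`= y - δ/4` for `y ≥ 3δ/8`. [cite: BuckmasterVicol2019Annals, §7] -/
def pumpCore (δ y : ℝ) : ℝ := δ / 16 + cut (5 * δ / 16) (δ / 16) y * (y - 5 * δ / 16)

/-- `h_δ ≥ δ/16`. [folklore] -/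
theorem pumpCore_ge (hδ : 0 < δ) (y : ℝ) : δ / 16 ≤ pumpCore δ y := by
  unfold pumpCore
  rcases le_or_gt y (5 * δ / 16) with h | h
  · rw [cut_of_le (by positivity) h]; linarith
  · have := (cut_mem (5 * δ / 16) (δ / 16) y).1
    nlinarith

/-- `h_δ > 0`. [folklore] -/
theorem pumpCore_pos (hδ : 0 < δ) (y : ℝ) : 0 < pumpCore δ y := lt_of_lt_of_le (by positivity) (pumpCore_ge hδ y)

/-- `h_δ(y) = y - δ/4` for `y ≥ 3δ/8`. [folklore] -/
theorem pumpCore_of_ge (hδ : 0 < δ) {y : ℝ} (hy : 3 * δ / 8 ≤ y) : pumpCore δ y = y - δ / 4 := by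
  unfold pumpCore
  rw [cut_of_ge (by positivity) (by linarith)]; ring

/-- `h_δ ≤ |y| + δ`. [folklore] -/
theorem pumpCore_le (hδ : 0 < δ) (y : ℝ) : pumpCore δ y ≤ |y| + δ := by
  unfold pumpCore
  rcases le_or_gt y (5 * δ / 16) with h | h
  · rw [cut_of_le (by positivity) h]; have := abs_nonneg y; linarith
  · have h1 := (cut_mem (5 * δ / 16) (δ / 16) y).2
    have h0 := (cut_mem (5 * δ / 16) (δ / 16) y).1
    have : cut (5 * δ / 16) (δ / 16) y * (y - 5 * δ / 16) ≤ 1 * (y - 5 * δ / 16) := mul_le_mul_of_nonneg_right h1 (by linarith)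
    have := le_abs_self y
    linarith

/-- `h_δ` is smooth. [folklore] -/
theorem contDiff_pumpCore (δ : ℝ) : ContDiff ℝ ∞ (pumpCore δ) :=
  contDiff_const.add ((contDiff_cut _ _).mul (contDiff_id.sub contDiff_const))

/-- The derivative of `h_δ` and its bound `|h_δ'| ≤ D₁ + 1`. [folklore] -/
theorem abs_deriv_pumpCore_le (hδ : 0 < δ) (y : ℝ) : |deriv (pumpCore δ) y| ≤ D₁ + 1 := by
  have hh : (0 : ℝ) < δ / 16 := by positivity
  have hd : HasDerivAt (pumpCore δ) (deriv (cut (5 * δ / 16) (δ / 16)) y * (y - 5 * δ / 16) + cut (5 * δ / 16) (δ / 16) y * 1) y := by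
    unfold pumpCore
    exact (((hasDerivAt_cut _ _ y).deriv ▸ (hasDerivAt_cut (5 * δ / 16) (δ / 16) y)).mul ((hasDerivAt_id y).sub_const _)).const_add _
  rw [hd.deriv, mul_one]
  have hc := cut_mem (5 * δ / 16) (δ / 16) y
  rcases le_or_gt y (5 * δ / 16) with h | h
  · -- below the transition: `cut' = 0`
    have h0 : deriv (cut (5 * δ / 16) (δ / 16)) y = 0 := by
      rw [deriv_cut]; simp only
      rw [deriv_smoothTransition_of_nonpos (div_nonpos_of_nonpos_of_nonneg (by linarith) hh.le), mul_zero]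
    rw [h0, zero_mul, zero_add, abs_of_nonneg hc.1]
    linarith [hc.2, D₁_nonneg]
  rcases le_or_gt (5 * δ / 16 + δ / 16) y with h' | h'
  · -- above: `cut' = 0`
    have h0 : deriv (cut (5 * δ / 16) (δ / 16)) y = 0 := by
      rw [deriv_cut]; simp only
      rw [deriv_smoothTransition_of_one_le ((one_le_div hh).2 (by linarith)), mul_zero]
    rw [h0, zero_mul, zero_add, abs_of_nonneg hc.1]
    linarith [hc.2, D₁_nonneg]
  · -- in the transition zone `0 < y - 5δ/16 < δ/16`
    have h1 := abs_deriv_cut_le hh y (a := 5 * δ / 16)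
    have hy : |y - 5 * δ / 16| ≤ δ / 16 := by rw [abs_of_pos (by linarith)]; linarith
    calc _ ≤ |deriv (cut (5 * δ / 16) (δ / 16)) y * (y - 5 * δ / 16)| + |cut (5 * δ / 16) (δ / 16) y| := abs_add_le _ _
      _ ≤ D₁ / (δ / 16) * (δ / 16) + 1 := by
          rw [abs_mul, abs_of_nonneg hc.1]
          exact add_le_add (mul_le_mul h1 hy (abs_nonneg _) (by have := D₁_nonneg; positivity)) hc.2
      _ = D₁ + 1 := by field_simp

/-- **The pump profile** `ψ_δ(y) = √(h_δ(y)) · cut(3δ/8, δ/8)(y)`. [cite: BuckmasterVicol2019Annals, §7] -/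
def pumpProfile (δ y : ℝ) : ℝ := Real.sqrt (pumpCore δ y) * cut (3 * δ / 8) (δ / 8) y

/-- `ψ_δ ≥ 0`. [folklore] -/
theorem pumpProfile_nonneg (δ y : ℝ) : 0 ≤ pumpProfile δ y := mul_nonneg (Real.sqrt_nonneg _) (cut_mem _ _ _).1

/-- `ψ_δ = 0` for `y ≤ 3δ/8`. [folklore] -/
theorem pumpProfile_of_le (hδ : 0 < δ) {y : ℝ} (hy : y ≤ 3 * δ / 8) : pumpProfile δ y = 0 := by
  unfold pumpProfile; rw [cut_of_le (by positivity) hy, mul_zero]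

/-- **`ψ_δ² = (y - δ/4) · cut²`**. [folklore] -/
theorem pumpProfile_sq (hδ : 0 < δ) (y : ℝ) : pumpProfile δ y ^ 2 = (y - δ / 4) * cut (3 * δ / 8) (δ / 8) y ^ 2 := by
  unfold pumpProfile
  rcases le_or_gt y (3 * δ / 8) with h | h
  · rw [cut_of_le (by positivity) h]; ring
  · rw [mul_pow, Real.sq_sqrt (pumpCore_pos hδ y).le, pumpCore_of_ge hδ h.le]

/-- `ψ_δ² = y - δ/4` for `y ≥ δ/2`. [folklore] -/
theorem pumpProfile_sq_of_ge (hδ : 0 < δ) {y : ℝ} (hy : δ / 2 ≤ y) : pumpProfile δ y ^ 2 = y - δ / 4 := by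
  rw [pumpProfile_sq hδ, cut_of_ge (by positivity) (by linarith)]; ring

/-- `ψ_δ² ≤ max (y - δ/4) 0`: the pumped energy never exceeds the gap above `δ/4`. [folklore] -/
theorem pumpProfile_sq_le (hδ : 0 < δ) (y : ℝ) : pumpProfile δ y ^ 2 ≤ max (y - δ / 4) 0 := by
  rw [pumpProfile_sq hδ]
  rcases le_or_gt y (3 * δ / 8) with h | h
  · rw [cut_of_le (by positivity) h]; simp
  · have hc := cut_mem (3 * δ / 8) (δ / 8) y
    have h1 : cut (3 * δ / 8) (δ / 8) y ^ 2 ≤ 1 := by nlinarith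
    calc (y - δ / 4) * cut (3 * δ / 8) (δ / 8) y ^ 2 ≤ (y - δ / 4) * 1 := mul_le_mul_of_nonneg_left h1 (by linarith)
      _ ≤ max (y - δ / 4) 0 := by rw [mul_one]; exact le_max_left _ _

/-- `(y - δ/4) - ψ_δ² ∈ [0, δ/4]` for `y ≥ 3δ/8` hmm: precisely, for `3δ/8 ≤ y` one has
`0 ≤ (y - δ/4) - ψ_δ(y)² ≤ (y - δ/4)(1 - cut²)` and the latter vanishes for `y ≥ δ/2`; the useful
form: `y - ψ_δ(y)² ∈ [δ/4, y]` for `y ≥ 3δ/8` and `∈ [δ/4, δ/2]` hmm for `y ≥ δ/2` it is `= δ/4`.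
We record: `δ/4 ≤ y - ψ_δ(y)²` for `y ≥ δ/4`, and `y - ψ_δ(y)² ≤ δ/2` for `y ≥ δ/2` hmm (equality `δ/4`).
[folklore] -/
theorem sub_pumpProfile_sq_bounds (hδ : 0 < δ) {y : ℝ} (hy : δ / 4 ≤ y) :
    δ / 4 ≤ y - pumpProfile δ y ^ 2 ∧ (δ / 2 ≤ y → y - pumpProfile δ y ^ 2 = δ / 4) ∧ y - pumpProfile δ y ^ 2 ≤ y := by
  refine ⟨?_, fun h => by rw [pumpProfile_sq_of_ge hδ h]; ring, by linarith [sq_nonneg (pumpProfile δ y)]⟩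
  have := pumpProfile_sq_le hδ y
  rw [max_eq_left (by linarith)] at this
  linarith

/-- `ψ_δ` is smooth. [folklore] -/
theorem contDiff_pumpProfile (hδ : 0 < δ) : ContDiff ℝ ∞ (pumpProfile δ) :=
  ((contDiff_pumpCore δ).sqrt fun y => (pumpCore_pos hδ y).ne').mul (contDiff_cut _ _)

/-- **The derivative bound of the pump profile**:
`|ψ_δ'(y)| ≤ 2(D₁ + 1)/√δ + 8 D₁ √(|y| + δ)/δ`. [folklore] -/
theorem abs_deriv_pumpProfile_le (hδ : 0 < δ) (y : ℝ) :
    |deriv (pumpProfile δ) y| ≤ 2 * (D₁ + 1) / Real.sqrt δ + 8 * D₁ * Real.sqrt (|y| + δ) / δ := by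
  have hpos := pumpCore_pos hδ y
  have hsq : HasDerivAt (fun z => Real.sqrt (pumpCore δ z)) (deriv (pumpCore δ) y / (2 * Real.sqrt (pumpCore δ y))) y :=
    (((contDiff_pumpCore δ).differentiable (by simp)) y).hasDerivAt.sqrt hpos.ne'
  have hd : HasDerivAt (pumpProfile δ) (deriv (pumpCore δ) y / (2 * Real.sqrt (pumpCore δ y)) * cut (3 * δ / 8) (δ / 8) y +
      Real.sqrt (pumpCore δ y) * deriv (cut (3 * δ / 8) (δ / 8)) y) y := by
    unfold pumpProfile
    exact hsq.mul ((hasDerivAt_cut _ _ y).deriv ▸ hasDerivAt_cut (3 * δ / 8) (δ / 8) y)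
  rw [hd.deriv]
  have hc := cut_mem (3 * δ / 8) (δ / 8) y
  have hsqrt : Real.sqrt (δ / 16) ≤ Real.sqrt (pumpCore δ y) := Real.sqrt_le_sqrt (pumpCore_ge hδ y)
  have hs16 : Real.sqrt (δ / 16) = Real.sqrt δ / 4 := by
    rw [show δ / 16 = δ / (4 ^ 2) by norm_num, Real.sqrt_div' _ (by norm_num), Real.sqrt_sq (by norm_num)]
  have hsδ : 0 < Real.sqrt δ := Real.sqrt_pos.2 hδ
  have hspos : 0 < Real.sqrt (pumpCore δ y) := Real.sqrt_pos.2 hpos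
  refine (abs_add_le _ _).trans (add_le_add ?_ ?_)
  · rw [abs_mul, abs_of_nonneg hc.1, abs_div, abs_mul, abs_two, abs_of_pos hspos]
    calc |deriv (pumpCore δ) y| / (2 * Real.sqrt (pumpCore δ y)) * cut (3 * δ / 8) (δ / 8) y
        ≤ (D₁ + 1) / (2 * (Real.sqrt δ / 4)) * 1 := by
          refine mul_le_mul ?_ hc.2 hc.1 (by have := D₁_nonneg; positivity)
          rw [hs16] at hsqrt
          exact div_le_div₀ (by linarith [D₁_nonneg]) (abs_deriv_pumpCore_le hδ y) (by positivity) (by linarith)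
      _ = 2 * (D₁ + 1) / Real.sqrt δ := by field_simp; ring
  · rw [abs_mul, abs_of_pos hspos]
    have h1 : Real.sqrt (pumpCore δ y) ≤ Real.sqrt (|y| + δ) := Real.sqrt_le_sqrt (pumpCore_le hδ y)
    have h2 : |deriv (cut (3 * δ / 8) (δ / 8)) y| ≤ D₁ / (δ / 8) := abs_deriv_cut_le (by positivity) y
    calc Real.sqrt (pumpCore δ y) * |deriv (cut (3 * δ / 8) (δ / 8)) y| ≤ Real.sqrt (|y| + δ) * (D₁ / (δ / 8)) :=
          mul_le_mul h1 h2 (abs_nonneg _) (Real.sqrt_nonneg _)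
      _ = 8 * D₁ * Real.sqrt (|y| + δ) / δ := by field_simp

/-- `ψ_δ > 0` for `y > 3δ/8`. [folklore] -/
theorem pumpProfile_pos (hδ : 0 < δ) {y : ℝ} (hy : 3 * δ / 8 < y) : 0 < pumpProfile δ y :=
  mul_pos (Real.sqrt_pos.2 (pumpCore_pos hδ y)) (cut_pos (by positivity) hy)

/-- `ψ_δ = 0` iff `y ≤ 3δ/8`. [folklore] -/
theorem pumpProfile_eq_zero_iff (hδ : 0 < δ) {y : ℝ} : pumpProfile δ y = 0 ↔ y ≤ 3 * δ / 8 := by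
  constructor
  · intro h; by_contra hy; exact (pumpProfile_pos hδ (lt_of_not_ge hy)).ne' h
  · exact pumpProfile_of_le hδ

/-- `ψ_δ' = 0` for `y ≤ 3δ/8` (`ψ_δ` vanishes to the left, and `cut(3δ/8) = cut'(3δ/8) = 0`). [folklore] -/
theorem deriv_pumpProfile_of_le (hδ : 0 < δ) {y : ℝ} (hy : y ≤ 3 * δ / 8) : deriv (pumpProfile δ) y = 0 := by
  have hpos := pumpCore_pos hδ y
  have hsq : HasDerivAt (fun z => Real.sqrt (pumpCore δ z)) (deriv (pumpCore δ) y / (2 * Real.sqrt (pumpCore δ y))) y :=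
    (((contDiff_pumpCore δ).differentiable (by simp)) y).hasDerivAt.sqrt hpos.ne'
  have hd : HasDerivAt (pumpProfile δ) (deriv (pumpCore δ) y / (2 * Real.sqrt (pumpCore δ y)) * cut (3 * δ / 8) (δ / 8) y +
      Real.sqrt (pumpCore δ y) * deriv (cut (3 * δ / 8) (δ / 8)) y) y := by
    unfold pumpProfile
    exact hsq.mul ((hasDerivAt_cut _ _ y).deriv ▸ hasDerivAt_cut (3 * δ / 8) (δ / 8) y)
  rw [hd.deriv, cut_of_le (by positivity) hy, deriv_cut_of_le (by positivity) hy]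
  simp

/-- **The floor function** `floorFun c y = c/2 + cut(c/2, c/2)(y) · (y - c/2)`: smooth, `≥ c/2`,
and `= y` for `y ≥ c`. [folklore] -/
def floorFun (c y : ℝ) : ℝ := c / 2 + cut (c / 2) (c / 2) y * (y - c / 2)

/-- `floorFun c ≥ c/2`. [folklore] -/
theorem floorFun_ge (hc : 0 < c) (y : ℝ) : c / 2 ≤ floorFun c y := by
  unfold floorFun
  rcases le_or_gt y (c / 2) with h | h
  · rw [cut_of_le (by positivity) h]; linarith
  · have := (cut_mem (c / 2) (c / 2) y).1; nlinarith

/-- `floorFun c > 0`. [folklore] -/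
theorem floorFun_pos (hc : 0 < c) (y : ℝ) : 0 < floorFun c y := lt_of_lt_of_le (by positivity) (floorFun_ge hc y)

/-- `floorFun c y = y` for `y ≥ c`. [folklore] -/
theorem floorFun_of_ge (hc : 0 < c) {y : ℝ} (hy : c ≤ y) : floorFun c y = y := by
  unfold floorFun; rw [cut_of_ge (by positivity) (by linarith)]; ring

/-- `floorFun c` is smooth. [folklore] -/
theorem contDiff_floorFun (c : ℝ) : ContDiff ℝ ∞ (floorFun c) :=
  contDiff_const.add ((contDiff_cut _ _).mul (contDiff_id.sub contDiff_const))

/-- `|floorFun'| ≤ D₁ + 1`. [folklore] -/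
theorem abs_deriv_floorFun_le (hc : 0 < c) (y : ℝ) : |deriv (floorFun c) y| ≤ D₁ + 1 := by
  have hh : (0 : ℝ) < c / 2 := by positivity
  have hd : HasDerivAt (floorFun c) (deriv (cut (c / 2) (c / 2)) y * (y - c / 2) + cut (c / 2) (c / 2) y * 1) y := by
    unfold floorFun
    exact (((hasDerivAt_cut _ _ y).deriv ▸ (hasDerivAt_cut (c / 2) (c / 2) y)).mul ((hasDerivAt_id y).sub_const _)).const_add _
  rw [hd.deriv, mul_one]
  have hcm := cut_mem (c / 2) (c / 2) y
  rcases le_or_gt y (c / 2) with h | h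
  · have h0 : deriv (cut (c / 2) (c / 2)) y = 0 := by
      rw [deriv_cut]; simp only
      rw [deriv_smoothTransition_of_nonpos (div_nonpos_of_nonpos_of_nonneg (by linarith) hh.le), mul_zero]
    rw [h0, zero_mul, zero_add, abs_of_nonneg hcm.1]
    linarith [hcm.2, D₁_nonneg]
  rcases le_or_gt (c / 2 + c / 2) y with h' | h'
  · have h0 : deriv (cut (c / 2) (c / 2)) y = 0 := by
      rw [deriv_cut]; simp only
      rw [deriv_smoothTransition_of_one_le ((one_le_div hh).2 (by linarith)), mul_zero]
    rw [h0, zero_mul, zero_add, abs_of_nonneg hcm.1]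
    linarith [hcm.2, D₁_nonneg]
  · have h1 := abs_deriv_cut_le hh y (a := c / 2)
    have hy : |y - c / 2| ≤ c / 2 := by rw [abs_of_pos (by linarith)]; linarith
    calc _ ≤ |deriv (cut (c / 2) (c / 2)) y * (y - c / 2)| + |cut (c / 2) (c / 2) y| := abs_add_le _ _
      _ ≤ D₁ / (c / 2) * (c / 2) + 1 := by
          rw [abs_mul, abs_of_nonneg hcm.1]
          exact add_le_add (mul_le_mul h1 hy (abs_nonneg _) (by have := D₁_nonneg; positivity)) hcm.2
      _ = D₁ + 1 := by field_simp

/-- **The inverse-square floor weight** `g = (floorFun c y)⁻²`: `0 < g ≤ 4/c²` and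
`|d/dy g| ≤ 2(D₁+1)(2/c)³`. [folklore] -/
theorem floorWeight_bounds (hc : 0 < c) (y : ℝ) :
    0 < (floorFun c y)⁻¹ ^ 2 ∧ (floorFun c y)⁻¹ ^ 2 ≤ (2 / c) ^ 2 ∧
    |deriv (fun z => (floorFun c z)⁻¹ ^ 2) y| ≤ 2 * (D₁ + 1) * (2 / c) ^ 3 := by
  have hf := floorFun_pos hc y
  have hge := floorFun_ge hc y
  have hinv : (floorFun c y)⁻¹ ≤ 2 / c := by rw [inv_le_comm₀ hf (by positivity)]; rwa [inv_div]
  have hinv0 : 0 < (floorFun c y)⁻¹ := inv_pos.2 hf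
  refine ⟨by positivity, pow_le_pow_left₀ hinv0.le hinv 2, ?_⟩
  have hf0 : floorFun c y ≠ 0 := hf.ne'
  have hd0 : HasDerivAt (floorFun c) (deriv (floorFun c) y) y := (((contDiff_floorFun c).differentiable (by simp)) y).hasDerivAt
  have h1 : HasDerivAt (fun z => (floorFun c z)⁻¹) (-(deriv (floorFun c) y) / (floorFun c y) ^ 2) y := hd0.inv hf0
  have h2 : HasDerivAt (fun z => (floorFun c z)⁻¹ ^ 2) (((2 : ℕ) : ℝ) * (floorFun c y)⁻¹ ^ (2 - 1) * (-(deriv (floorFun c) y) / (floorFun c y) ^ 2)) y :=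
    h1.pow 2
  rw [h2.deriv]
  have hb := abs_deriv_floorFun_le hc y
  have e : ((2 : ℕ) : ℝ) * (floorFun c y)⁻¹ ^ (2 - 1) * (-(deriv (floorFun c) y) / (floorFun c y) ^ 2) =
      -(2 * deriv (floorFun c) y * (floorFun c y)⁻¹ ^ 3) := by
    rw [show (2 : ℕ) - 1 = 1 from rfl, pow_one]; push_cast; field_simp
  rw [e, abs_neg, abs_mul, abs_mul, abs_two, abs_of_pos (pow_pos hinv0 3)]
  have h3 : (floorFun c y)⁻¹ ^ 3 ≤ (2 / c) ^ 3 := pow_le_pow_left₀ hinv0.le hinv 3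
  calc 2 * |deriv (floorFun c) y| * (floorFun c y)⁻¹ ^ 3 ≤ 2 * (D₁ + 1) * (2 / c) ^ 3 :=
        mul_le_mul (mul_le_mul_of_nonneg_left hb (by norm_num)) h3 (by positivity) (by linarith [D₁_nonneg])
    _ = _ := rfl

end Profiles

end EnergyPump

end Literature.Analysis.FluidPDE
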